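import Summits.AtomisticToContinuum.Crystallization.Theorems.ChartedPlanarOrderStraddleSummable
import Summits.AtomisticToContinuum.Crystallization.Theorems.ChartedPlanarOrderPlanesPointSums

/-!
# Slot 7b by the method of planes, module P3b: the pair-point family of a gap and its explicit domination (decomp-a2c lens-3 g26; R1)

Blocker `N = ChartedPlanarOrder.ChartedZeroExcessLayered`, leaf 7b `GapStressVanishesW (17/16)`.  The transmitted stress across gap `m` of a stacked
layered configuration `Y = Layered a b w` is the series, over the straddling layer pairs `k < m ≤ l` and the atoms `(l, μ)` of layer `l`, of the
pair forces `pairForce (w k − layerPoint a b w (l, μ))` — the PAIR-POINT FAMILY `gapFam a b w m` on `Straddle m × ℤ²` (§1; the layer force is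
its series over one layer, `layerForce_eq_tsum_layerPoint`).  This module proves the EXPLICIT, configuration-free domination of that family
which drives the whole 7b line (critic row 519 (1), R1: "the decay lemma first, constant explicit in `(h_min, δ₀)`"):

* §2 heights: under `h_lo ≤ ⟪ν, w (j+1) − w j⟫ ≤ h_hi` the layers `k < l` are `∈ [h_lo (l−k), h_hi (l−k)]` apart along the unit normal `ν`;
* §3 termwise: `‖gapFam q‖ ≤ K(δ) · c(Z_l − Z_k) · b b` (`…SepCounting.norm_pairForce_le_W3` in a frame `e` with `e 0 = ν`), and the normal
  factor is `c(Z_l − Z_k) ≤ (δ/2h_lo)³ (l − k)⁻³`;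
* §4 the planar factor summed over the atoms of ONE pair fibre is `≤ 32/(M+1)` (planar grid injectivity + `…PlanesDomination.sum_bWeight₂_le`);
* (span counting `∑_{pairs, span ≥ S} (l − k)⁻³ ≤ 2/S` is `…PlanesDomination.sum_span_inv_cube_le`);
* §5 ★ the generic grouped bound and the two MASTER BOUNDS for every finite set `T` of indices:
  TOTAL `∑_{q ∈ T} ‖gapFam q‖ ≤ 64 K(δ) (δ/2h_lo)³` and FAR TAIL `∑_{q ∈ T, ‖w k − y‖ > R} ‖gapFam q‖ ≤ 64 K(δ) (δ/2h_lo)³ (2 h_hi + δ) / R`,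
  `K(δ) = (δ⁻⁶ + 1)(4/δ)⁷` — the `1/R` DECAY of the truncation error of the gap stress (module P3c `…PlanesTail` turns it into
  `‖gapStress − Σ_window Φ_R‖ ≤ C₂/R`).

Mathlib only (+ the lens-3 modules imported); `[folklore]`; no instances, no notation, sorry-free.
-/

noncomputable section

open MeasureTheory Set Metric Filter Topology
open scoped RealInnerProductSpace
open Summit.AtomisticToContinuum.Crystallization.Theorems.ChartedPlanarOrderRigidityDoor
open Summit.AtomisticToContinuum.Crystallization.Theorems.ChartedPlanarOrderDensityDichotomy
open Summit.AtomisticToContinuum.Crystallization.Theorems.ChartedPlanarOrderMesoCut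
open Summit.AtomisticToContinuum.Crystallization.Theorems.ChartedPlanarOrderProfileSlavingLJ (pairForce layerForce IsStacked Straddle)
open Summit.AtomisticToContinuum.Crystallization.Theorems.ChartedPlanarOrderDoorLayered (Layered)
open Summit.AtomisticToContinuum.Crystallization.Theorems.ChartedPlanarOrderNashForceBalance
open Summit.AtomisticToContinuum.Crystallization.Theorems.ChartedPlanarOrderSepCounting
open Summit.AtomisticToContinuum.Crystallization.Theorems.ChartedPlanarOrderStraddleSummable (inner_layerPoint le_norm_sub_layerPoint)
open Summit.AtomisticToContinuum.Crystallization.Theorems.ChartedPlanarOrderPlanesDomination (sum_bWeight₂_le sum_span_inv_cube_le)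
open Summit.AtomisticToContinuum.Crystallization.Theorems.ChartedPlanarOrderPlanesPointSums (le_abs_floor_sub_floor exists_planar_coord_far)

namespace Summit.AtomisticToContinuum.Crystallization.Theorems.ChartedPlanarOrderPlanesPairs

variable {δ : ℝ} {a b ν : E3} {w : ℤ → E3} {h_lo h_hi : ℝ}

/-! ## 1. The pair-point family of a gap -/

section Family

/-- the PAIR-POINT FAMILY of gap `m`: the LJ pair force between the atom `w k` of the lower layer `k < m` and the atom `(l, μ)` of the upper
layer `l ≥ m`, indexed by `q = (⟨(k, l), _⟩, μ) ∈ Straddle m × ℤ²`. -/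
def gapFam (a b : E3) (w : ℤ → E3) (m : ℤ) (q : Straddle m × (ℤ × ℤ)) : E3 :=
  pairForce (w q.1.1.1 - layerPoint a b w (q.1.1.2, q.2))

/-- (F2) the layer force `layerForce a b (w k − w l)` is the series of the pair forces from the atoms of layer `l` on `w k`
(reindexing `μ ↦ −μ` of `ℤ²`; no summability needed). -/
theorem layerForce_eq_tsum_layerPoint (a b : E3) (w : ℤ → E3) (k l : ℤ) :
    layerForce a b (w k - w l) = ∑' μ : ℤ × ℤ, pairForce (w k - layerPoint a b w (l, μ)) := by
  unfold layerForce
  rw [← (Equiv.neg (ℤ × ℤ)).tsum_eq (fun μ : ℤ × ℤ => pairForce (w k - layerPoint a b w (l, μ)))]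
  refine tsum_congr fun μ => ?_
  congr 1
  simp only [Equiv.neg_apply, layerPoint, Prod.fst_neg, Prod.snd_neg, Int.cast_neg, neg_smul]
  abel

/-- the constant `K(δ) = (δ⁻⁶ + 1)(4/δ)⁷` of `…SepCounting.norm_pairForce_le_W3`. -/
def Kc (δ : ℝ) : ℝ := ((δ⁻¹) ^ 6 + 1) * (4 / δ) ^ 7

/-- `K(δ) ≥ 0` for `δ > 0`. -/
theorem Kc_nonneg (hδ : 0 < δ) : 0 ≤ Kc δ := by unfold Kc; positivity

/-- the PLANAR comparison factor of an index: `b(κ₂(y) − κ₂(x)) · b(κ₃(y) − κ₃(x))` for `x = w k`, `y = layerPoint (l, μ)` in the frame `e`. -/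
def planarW (δ : ℝ) (e : OrthonormalBasis (Fin 3) ℝ E3) (a b : E3) (w : ℤ → E3) (m : ℤ) (q : Straddle m × (ℤ × ℤ)) : ℝ :=
  bWeight ((gridE δ e (layerPoint a b w (q.1.1.2, q.2))).2.1 - (gridE δ e (w q.1.1.1)).2.1) *
    bWeight ((gridE δ e (layerPoint a b w (q.1.1.2, q.2))).2.2 - (gridE δ e (w q.1.1.1)).2.2)

/-- the planar factor is nonnegative. -/
theorem planarW_nonneg (e : OrthonormalBasis (Fin 3) ℝ E3) (m : ℤ) (q : Straddle m × (ℤ × ℤ)) : 0 ≤ planarW δ e a b w m q :=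
  mul_nonneg (bWeight_nonneg _) (bWeight_nonneg _)

end Family

/-! ## 2. Heights along the normal -/

section Heights

/-- heights of `s` consecutive layers add up to `∈ [h_lo s, h_hi s]`. -/
theorem heights_sum (hH : ∀ j : ℤ, h_lo ≤ ⟪ν, w (j + 1) - w j⟫ ∧ ⟪ν, w (j + 1) - w j⟫ ≤ h_hi) (k : ℤ) (s : ℕ) :
    h_lo * s ≤ ⟪ν, w (k + s)⟫ - ⟪ν, w k⟫ ∧ ⟪ν, w (k + s)⟫ - ⟪ν, w k⟫ ≤ h_hi * s := by
  induction s with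
  | zero => simp
  | succ s ih =>
    have h := hH (k + s)
    rw [inner_sub_right] at h
    have e : k + ((s + 1 : ℕ) : ℤ) = k + s + 1 := by push_cast; ring
    rw [e]
    push_cast
    constructor <;> nlinarith [h.1, h.2, ih.1, ih.2]

/-- layers `k ≤ l` are between `h_lo (l − k)` and `h_hi (l − k)` apart along `ν`. -/
theorem heights_of_le (hH : ∀ j : ℤ, h_lo ≤ ⟪ν, w (j + 1) - w j⟫ ∧ ⟪ν, w (j + 1) - w j⟫ ≤ h_hi) {k l : ℤ} (hkl : k ≤ l) :
    h_lo * ((l - k : ℤ) : ℝ) ≤ ⟪ν, w l⟫ - ⟪ν, w k⟫ ∧ ⟪ν, w l⟫ - ⟪ν, w k⟫ ≤ h_hi * ((l - k : ℤ) : ℝ) := by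
  obtain ⟨s, hs⟩ : ∃ s : ℕ, l = k + s := ⟨(l - k).toNat, by rw [Int.toNat_of_nonneg (sub_nonneg.mpr hkl)]; ring⟩
  subst hs
  have e : ((k + (s : ℤ) - k : ℤ) : ℝ) = (s : ℝ) := by push_cast; ring
  rw [e]
  exact heights_sum hH k s

/-- the stacking hypothesis from the height floor. -/
theorem isStacked_of_heights (hνa : ⟪ν, a⟫ = 0) (hνb : ⟪ν, b⟫ = 0) (hlo : 0 < h_lo)
    (hH : ∀ j : ℤ, h_lo ≤ ⟪ν, w (j + 1) - w j⟫ ∧ ⟪ν, w (j + 1) - w j⟫ ≤ h_hi) : IsStacked a b w :=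
  ⟨ν, hνa, hνb, fun j => lt_of_lt_of_le hlo (hH j).1⟩

end Heights

/-! ## 3. Termwise domination and the normal factor -/

section Termwise

/-- ★ termwise: `‖gapFam q‖ ≤ K(δ) · c(Z_y − Z_x) · planarW q` (`…SepCounting.norm_pairForce_le_W3`; distinct layers are `≥ δ` apart). -/
theorem norm_gapFam_le (hδ : 0 < δ) (hS : IsSep δ (Layered a b w)) (hab : LinearIndependent ℝ ![a, b]) (hst : IsStacked a b w)
    (e : OrthonormalBasis (Fin 3) ℝ E3) (m : ℤ) (q : Straddle m × (ℤ × ℤ)) :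
    ‖gapFam a b w m q‖ ≤ Kc δ * (cWeight ((gridE δ e (layerPoint a b w (q.1.1.2, q.2))).1 - (gridE δ e (w q.1.1.1)).1) *
      planarW δ e a b w m q) := by
  have hkl : q.1.1.1 ≠ q.1.1.2 := ne_of_lt (lt_of_lt_of_le q.1.2.1 q.1.2.2)
  have h := norm_pairForce_le_W3 hδ e (le_norm_sub_layerPoint hab hst hS (k := q.1.1.1) (t := (q.1.1.2, q.2)) hkl)
  simpa only [gapFam, Kc, W3, planarW] using h

/-- ★ the normal factor: `c(Z_l − Z_k) ≤ (δ/2h_lo)³ (l − k)⁻³` for `k < l` (the grid heights differ by `> (2/δ) h_lo (l − k) − 1`). -/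
theorem cWeight_normal_le (hδ : 0 < δ) (hνa : ⟪ν, a⟫ = 0) (hνb : ⟪ν, b⟫ = 0) (hlo : 0 < h_lo)
    (hH : ∀ j : ℤ, h_lo ≤ ⟪ν, w (j + 1) - w j⟫ ∧ ⟪ν, w (j + 1) - w j⟫ ≤ h_hi)
    (e : OrthonormalBasis (Fin 3) ℝ E3) (he : e 0 = ν) {k l : ℤ} (hkl : k < l) (μ : ℤ × ℤ) :
    cWeight ((gridE δ e (layerPoint a b w (l, μ))).1 - (gridE δ e (w k)).1) ≤
      (δ / (2 * h_lo)) ^ 3 * ((((l - k : ℤ) : ℝ)) ^ 3)⁻¹ := by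
  have hz : (gridE δ e (layerPoint a b w (l, μ))).1 = ⌊2 / δ * ⟪ν, w l⟫⌋ := by
    rw [gridE_fst, he, inner_layerPoint hνa hνb]
  have hzk : (gridE δ e (w k)).1 = ⌊2 / δ * ⟪ν, w k⟫⌋ := by rw [gridE_fst, he]
  rw [hz, hzk]
  set D : ℤ := ⌊2 / δ * ⟪ν, w l⟫⌋ - ⌊2 / δ * ⟪ν, w k⟫⌋ with hD
  set s : ℝ := ((l - k : ℤ) : ℝ) with hs
  have hs1 : (1 : ℝ) ≤ s := by rw [hs]; exact_mod_cast (show (1 : ℤ) ≤ l - k by omega)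
  have hHt := (heights_of_le hH hkl.le).1
  have hfl : 2 / δ * (⟪ν, w l⟫ - ⟪ν, w k⟫) - 1 < (D : ℝ) := by
    have h1 := Int.floor_le (2 / δ * ⟪ν, w k⟫)
    have h2 := Int.lt_floor_add_one (2 / δ * ⟪ν, w l⟫)
    rw [hD]; push_cast; nlinarith
  have hpos : 0 < 2 * h_lo / δ * s := by positivity
  have hkey : 2 * h_lo / δ * s ≤ 1 + |(D : ℝ)| := by
    have h3 := le_abs_self (D : ℝ)
    have h4 : 2 / δ * (h_lo * s) ≤ 2 / δ * (⟪ν, w l⟫ - ⟪ν, w k⟫) := mul_le_mul_of_nonneg_left hHt (by positivity)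
    have e1 : 2 * h_lo / δ * s = 2 / δ * (h_lo * s) := by ring
    linarith
  unfold cWeight
  calc ((1 + |(D : ℝ)|) ^ 3)⁻¹ ≤ ((2 * h_lo / δ * s) ^ 3)⁻¹ := inv_anti₀ (pow_pos hpos 3) (pow_le_pow_left₀ hpos.le hkey 3)
    _ = (δ / (2 * h_lo)) ^ 3 * (s ^ 3)⁻¹ := by
        have hδ0 : δ ≠ 0 := hδ.ne'
        have hl0 : h_lo ≠ 0 := hlo.ne'
        have hs0 : s ≠ 0 := by positivity
        field_simp

end Termwise

/-! ## 4. The planar factor summed over one pair fibre -/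

section Fibre

/-- ★ over the indices of ONE straddling pair `(k, l)` the planar factors sum to `≤ 32/(M+1)`, where `M` is a common lower bound for one of
the two planar grid separations of each atom from `w k` (`M = 0`: unconditional).  Planar grid coordinates are injective on a layer. -/
theorem fibre_sum_planarW_le (hδ : 0 < δ) (hS : IsSep δ (Layered a b w)) (hab : LinearIndependent ℝ ![a, b]) (hst : IsStacked a b w)
    (hνa : ⟪ν, a⟫ = 0) (hνb : ⟪ν, b⟫ = 0) (e : OrthonormalBasis (Fin 3) ℝ E3) (he : e 0 = ν) (m : ℤ) (p : ℤ × ℤ)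
    (U : Finset (Straddle m × (ℤ × ℤ))) (hU : ∀ q ∈ U, q.1.1 = p) (M : ℕ)
    (hM : ∀ q ∈ U, (M : ℤ) ≤ |(gridE δ e (layerPoint a b w (p.2, q.2))).2.1 - (gridE δ e (w p.1)).2.1| ∨
      (M : ℤ) ≤ |(gridE δ e (layerPoint a b w (p.2, q.2))).2.2 - (gridE δ e (w p.1)).2.2|) :
    ∑ q ∈ U, planarW δ e a b w m q ≤ 32 / ((M : ℝ) + 1) := by
  classical
  set c : ℤ × ℤ := ((gridE δ e (w p.1)).2.1, (gridE δ e (w p.1)).2.2) with hc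
  set φ : Straddle m × (ℤ × ℤ) → ℤ × ℤ := fun q =>
    ((gridE δ e (layerPoint a b w (p.2, q.2))).2.1, (gridE δ e (layerPoint a b w (p.2, q.2))).2.2) with hφ
  have hrw : ∀ q ∈ U, planarW δ e a b w m q = bWeight ((φ q).1 - c.1) * bWeight ((φ q).2 - c.2) := by
    intro q hq
    simp only [planarW, hU q hq, hφ, hc]
  have hinj : Set.InjOn φ U := by
    intro q hq q' hq' hqq
    simp only [hφ, Prod.mk.injEq] at hqq
    have h1 : (gridE δ e (layerPoint a b w (p.2, q.2))).1 = (gridE δ e (layerPoint a b w (p.2, q'.2))).1 := by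
      rw [gridE_fst, gridE_fst, he, inner_layerPoint hνa hνb, inner_layerPoint hνa hνb]
    have h3 : gridE δ e (layerPoint a b w (p.2, q.2)) = gridE δ e (layerPoint a b w (p.2, q'.2)) :=
      Prod.ext h1 (Prod.ext hqq.1 hqq.2)
    have h4 := gridE_injOn hδ e hS (layerPoint_mem _) (layerPoint_mem _) h3
    have h5 := layerPoint_injective hab hst h4
    have h6 : q.2 = q'.2 := (Prod.mk.inj h5).2
    have h7 : q.1 = q'.1 := Subtype.ext (by rw [hU q hq, hU q' hq'])
    exact Prod.ext h7 h6
  rw [Finset.sum_congr rfl hrw, ← Finset.sum_image (f := fun κ : ℤ × ℤ => bWeight (κ.1 - c.1) * bWeight (κ.2 - c.2)) hinj]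
  refine sum_bWeight₂_le c (U.image φ) M fun κ hκ => ?_
  obtain ⟨q, hq, rfl⟩ := Finset.mem_image.mp hκ
  exact hM q hq

end Fibre

/-! ## 5. The generic grouped bound and the master bounds -/

section Master

/-- ★ GENERIC GROUPED BOUND: if every index of `T` has span `≥ S ≥ 1` and the planar factors of every pair fibre of `T` sum to `≤ β`, then
`∑_{q ∈ T} ‖gapFam q‖ ≤ K(δ) (δ/2h_lo)³ β (2/S)`. -/
theorem sum_norm_gapFam_le_gen (hδ : 0 < δ) (hS : IsSep δ (Layered a b w)) (hab : LinearIndependent ℝ ![a, b])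
    (hνa : ⟪ν, a⟫ = 0) (hνb : ⟪ν, b⟫ = 0) (hlo : 0 < h_lo)
    (hH : ∀ j : ℤ, h_lo ≤ ⟪ν, w (j + 1) - w j⟫ ∧ ⟪ν, w (j + 1) - w j⟫ ≤ h_hi)
    (e : OrthonormalBasis (Fin 3) ℝ E3) (he : e 0 = ν) (m : ℤ) (T : Finset (Straddle m × (ℤ × ℤ))) {S : ℕ} (hS1 : 1 ≤ S)
    (hspan : ∀ q ∈ T, (S : ℤ) ≤ q.1.1.2 - q.1.1.1) {β : ℝ} (hβ0 : 0 ≤ β)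
    (hβ : ∀ p ∈ T.image fun q => q.1.1, ∑ q ∈ T.filter (fun q => q.1.1 = p), planarW δ e a b w m q ≤ β) :
    ∑ q ∈ T, ‖gapFam a b w m q‖ ≤ Kc δ * (δ / (2 * h_lo)) ^ 3 * β * (2 / S) := by
  classical
  have hst : IsStacked a b w := isStacked_of_heights hνa hνb hlo hH
  set γ : ℝ := (δ / (2 * h_lo)) ^ 3 with hγ
  have hK : 0 ≤ Kc δ := Kc_nonneg hδ
  have hγ0 : 0 ≤ γ := by positivity
  have hsnn : ∀ p : ℤ × ℤ, p.1 < m ∧ m ≤ p.2 → (0 : ℝ) ≤ ((((p.2 - p.1 : ℤ) : ℝ)) ^ 3)⁻¹ := fun p hp => by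
    have h0 : (0 : ℝ) ≤ ((p.2 - p.1 : ℤ) : ℝ) := by exact_mod_cast (show (0 : ℤ) ≤ p.2 - p.1 by omega)
    positivity
  have hterm : ∀ q ∈ T, ‖gapFam a b w m q‖ ≤
      (Kc δ * γ) * (((((q.1.1.2 - q.1.1.1 : ℤ) : ℝ)) ^ 3)⁻¹ * planarW δ e a b w m q) := by
    intro q _
    have hkl : q.1.1.1 < q.1.1.2 := lt_of_lt_of_le q.1.2.1 q.1.2.2
    have h1 := norm_gapFam_le hδ hS hab hst e m q
    have h2 := cWeight_normal_le hδ hνa hνb hlo hH e he hkl q.2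
    have hB := planarW_nonneg (δ := δ) (a := a) (b := b) (w := w) e m q
    calc ‖gapFam a b w m q‖ ≤ Kc δ * (cWeight ((gridE δ e (layerPoint a b w (q.1.1.2, q.2))).1 - (gridE δ e (w q.1.1.1)).1) *
          planarW δ e a b w m q) := h1
      _ ≤ Kc δ * ((γ * ((((q.1.1.2 - q.1.1.1 : ℤ) : ℝ)) ^ 3)⁻¹) * planarW δ e a b w m q) :=
          mul_le_mul_of_nonneg_left (mul_le_mul_of_nonneg_right h2 hB) hK
      _ = (Kc δ * γ) * (((((q.1.1.2 - q.1.1.1 : ℤ) : ℝ)) ^ 3)⁻¹ * planarW δ e a b w m q) := by ring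
  have hPst : ∀ p ∈ T.image (fun q => q.1.1), p.1 < m ∧ m ≤ p.2 := fun p hp => by
    obtain ⟨q, _, rfl⟩ := Finset.mem_image.mp hp
    exact ⟨q.1.2.1, q.1.2.2⟩
  calc ∑ q ∈ T, ‖gapFam a b w m q‖
        ≤ ∑ q ∈ T, (Kc δ * γ) * (((((q.1.1.2 - q.1.1.1 : ℤ) : ℝ)) ^ 3)⁻¹ * planarW δ e a b w m q) := Finset.sum_le_sum hterm
    _ = (Kc δ * γ) * ∑ q ∈ T, ((((q.1.1.2 - q.1.1.1 : ℤ) : ℝ)) ^ 3)⁻¹ * planarW δ e a b w m q := by rw [Finset.mul_sum]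
    _ = (Kc δ * γ) * ∑ p ∈ T.image (fun q => q.1.1), ∑ q ∈ T.filter (fun q => q.1.1 = p),
          ((((q.1.1.2 - q.1.1.1 : ℤ) : ℝ)) ^ 3)⁻¹ * planarW δ e a b w m q := by
        rw [Finset.sum_fiberwise_of_maps_to (fun q hq => Finset.mem_image_of_mem (fun q => q.1.1) hq)]
    _ = (Kc δ * γ) * ∑ p ∈ T.image (fun q => q.1.1), ((((p.2 - p.1 : ℤ) : ℝ)) ^ 3)⁻¹ *
          ∑ q ∈ T.filter (fun q => q.1.1 = p), planarW δ e a b w m q := by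
        congr 1
        refine Finset.sum_congr rfl fun p _ => ?_
        rw [Finset.mul_sum]
        refine Finset.sum_congr rfl fun q hq => ?_
        rw [(Finset.mem_filter.mp hq).2]
    _ ≤ (Kc δ * γ) * ∑ p ∈ T.image (fun q => q.1.1), ((((p.2 - p.1 : ℤ) : ℝ)) ^ 3)⁻¹ * β := by
        refine mul_le_mul_of_nonneg_left (Finset.sum_le_sum fun p hp => ?_) (mul_nonneg hK hγ0)
        exact mul_le_mul_of_nonneg_left (hβ p hp) (hsnn p (hPst p hp))
    _ = (Kc δ * γ * β) * ∑ p ∈ T.image (fun q => q.1.1), ((((p.2 - p.1 : ℤ) : ℝ)) ^ 3)⁻¹ := by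
        rw [← Finset.sum_mul]; ring
    _ ≤ (Kc δ * γ * β) * (2 / S) := by
        refine mul_le_mul_of_nonneg_left (sum_span_inv_cube_le m _ hPst hS1 fun p hp => ?_) (by positivity)
        obtain ⟨q, hq, rfl⟩ := Finset.mem_image.mp hp
        exact hspan q hq
    _ = Kc δ * (δ / (2 * h_lo)) ^ 3 * β * (2 / S) := by rw [hγ]

/-- ★★ MASTER BOUND I (total): `∑_{q ∈ T} ‖gapFam q‖ ≤ 64 K(δ) (δ/2h_lo)³` for EVERY finite set `T` of indices of gap `m`. -/
theorem sum_norm_gapFam_le_total (hδ : 0 < δ) (hS : IsSep δ (Layered a b w)) (hab : LinearIndependent ℝ ![a, b])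
    (hνa : ⟪ν, a⟫ = 0) (hνb : ⟪ν, b⟫ = 0) (hlo : 0 < h_lo)
    (hH : ∀ j : ℤ, h_lo ≤ ⟪ν, w (j + 1) - w j⟫ ∧ ⟪ν, w (j + 1) - w j⟫ ≤ h_hi)
    (e : OrthonormalBasis (Fin 3) ℝ E3) (he : e 0 = ν) (m : ℤ) (T : Finset (Straddle m × (ℤ × ℤ))) :
    ∑ q ∈ T, ‖gapFam a b w m q‖ ≤ 64 * Kc δ * (δ / (2 * h_lo)) ^ 3 := by
  classical
  have hst : IsStacked a b w := isStacked_of_heights hνa hνb hlo hH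
  have h := sum_norm_gapFam_le_gen hδ hS hab hνa hνb hlo hH e he m T (S := 1) le_rfl
    (fun q _ => by have := q.1.2.1; have := q.1.2.2; push_cast; omega) (β := 32) (by norm_num)
    (fun p hp => (fibre_sum_planarW_le hδ hS hab hst hνa hνb e he m p (T.filter fun q => q.1.1 = p)
      (fun q hq => (Finset.mem_filter.mp hq).2) 0 (fun q _ => Or.inl (by simp))).trans (by norm_num))
  have e1 : Kc δ * (δ / (2 * h_lo)) ^ 3 * 32 * (2 / ((1 : ℕ) : ℝ)) = 64 * Kc δ * (δ / (2 * h_lo)) ^ 3 := by norm_num; ring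
  rw [e1] at h
  exact h

/-- ★★ MASTER BOUND II (far tail, the `1/R` DECAY): if every index of `T` is FAR — its atom `layerPoint (l, μ)` is at distance `> R` from
`w k` — then `∑_{q ∈ T} ‖gapFam q‖ ≤ 64 K(δ) (δ/2h_lo)³ (2 h_hi + δ) / R`.  (Pairs of span `> R/2h_hi` carry `∑_{s ≳ R/2h_hi} s⁻² ≲ h_hi/R`;
pairs of span `≤ R/2h_hi` see the far atoms at planar grid distance `≳ R/δ`, each fibre carrying `≲ δ/R`.) -/
theorem sum_norm_gapFam_le_tail (hδ : 0 < δ) (hS : IsSep δ (Layered a b w)) (hab : LinearIndependent ℝ ![a, b])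
    (hνa : ⟪ν, a⟫ = 0) (hνb : ⟪ν, b⟫ = 0) (hlo : 0 < h_lo) (hhi : 0 < h_hi)
    (hH : ∀ j : ℤ, h_lo ≤ ⟪ν, w (j + 1) - w j⟫ ∧ ⟪ν, w (j + 1) - w j⟫ ≤ h_hi)
    (e : OrthonormalBasis (Fin 3) ℝ E3) (he : e 0 = ν) (m : ℤ) (T : Finset (Straddle m × (ℤ × ℤ))) {R : ℝ} (hR : 0 < R)
    (hfar : ∀ q ∈ T, R < ‖w q.1.1.1 - layerPoint a b w (q.1.1.2, q.2)‖) :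
    ∑ q ∈ T, ‖gapFam a b w m q‖ ≤ 64 * Kc δ * (δ / (2 * h_lo)) ^ 3 * (2 * h_hi + δ) / R := by
  classical
  have hst : IsStacked a b w := isStacked_of_heights hνa hνb hlo hH
  have hK : 0 ≤ Kc δ := Kc_nonneg hδ
  set γ : ℝ := (δ / (2 * h_lo)) ^ 3 with hγ
  have hγ0 : 0 ≤ γ := by positivity
  set A : Straddle m × (ℤ × ℤ) → Prop := fun q => R < 2 * h_hi * ((q.1.1.2 - q.1.1.1 : ℤ) : ℝ) with hA
  rw [← Finset.sum_filter_add_sum_filter_not T A]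
  -- (α) pairs of large span
  set Sα : ℕ := ⌊R / (2 * h_hi)⌋₊ + 1 with hSα
  have hx0 : 0 ≤ R / (2 * h_hi) := by positivity
  have hα : ∑ q ∈ T.filter A, ‖gapFam a b w m q‖ ≤ Kc δ * γ * 32 * (2 / Sα) := by
    refine sum_norm_gapFam_le_gen hδ hS hab hνa hνb hlo hH e he m (T.filter A) (S := Sα) (by omega) (fun q hq => ?_)
      (β := 32) (by norm_num) (fun p hp => (fibre_sum_planarW_le hδ hS hab hst hνa hνb e he m p _
        (fun q hq => (Finset.mem_filter.mp hq).2) 0 (fun q _ => Or.inl (by simp))).trans (by norm_num))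
    have hq' : R < 2 * h_hi * ((q.1.1.2 - q.1.1.1 : ℤ) : ℝ) := (Finset.mem_filter.mp hq).2
    have h0 : 0 ≤ q.1.1.2 - q.1.1.1 := by have := q.1.2.1; have := q.1.2.2; omega
    set n : ℕ := (q.1.1.2 - q.1.1.1).toNat with hn
    have hn1 : ((n : ℕ) : ℤ) = q.1.1.2 - q.1.1.1 := Int.toNat_of_nonneg h0
    have hn2 : ((q.1.1.2 - q.1.1.1 : ℤ) : ℝ) = (n : ℝ) := by rw [← hn1, Int.cast_natCast]
    rw [hn2] at hq'
    have h3 : R / (2 * h_hi) < n := by rw [div_lt_iff₀ (by positivity)]; linarith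
    have h4 : ⌊R / (2 * h_hi)⌋₊ < n := (Nat.floor_lt hx0).mpr h3
    rw [← hn1]
    exact_mod_cast (show Sα ≤ n by omega)
  have hα' : Kc δ * γ * 32 * (2 / Sα) ≤ 128 * Kc δ * γ * h_hi / R := by
    have h1 : R / (2 * h_hi) < Sα := by rw [hSα]; push_cast; exact Nat.lt_floor_add_one _
    have h2 : (1 : ℝ) / Sα ≤ 2 * h_hi / R := by
      have h3 : 0 < (Sα : ℝ) := lt_of_le_of_lt hx0 h1
      rw [div_le_div_iff₀ h3 hR]
      rw [div_lt_iff₀ (by positivity)] at h1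
      linarith
    have h4 : 0 ≤ Kc δ * γ * 64 := by positivity
    calc Kc δ * γ * 32 * (2 / Sα) = Kc δ * γ * 64 * (1 / Sα) := by ring
      _ ≤ Kc δ * γ * 64 * (2 * h_hi / R) := mul_le_mul_of_nonneg_left h2 h4
      _ = 128 * Kc δ * γ * h_hi / R := by ring
  -- (β) pairs of small span: far atoms are planar-far
  set M : ℕ := ⌊R / δ⌋₊ with hM
  have hMR : (M : ℝ) * δ ≤ R := by
    have h1 : (M : ℝ) ≤ R / δ := Nat.floor_le (by positivity)
    calc (M : ℝ) * δ ≤ R / δ * δ := mul_le_mul_of_nonneg_right h1 hδ.le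
      _ = R := div_mul_cancel₀ R hδ.ne'
  have hβ : ∑ q ∈ T.filter (fun q => ¬A q), ‖gapFam a b w m q‖ ≤ Kc δ * γ * (32 / ((M : ℝ) + 1)) * (2 / ((1 : ℕ) : ℝ)) := by
    refine sum_norm_gapFam_le_gen hδ hS hab hνa hνb hlo hH e he m _ (S := 1) le_rfl
      (fun q _ => by have := q.1.2.1; have := q.1.2.2; push_cast; omega) (β := 32 / ((M : ℝ) + 1)) (by positivity)
      (fun p hp => fibre_sum_planarW_le hδ hS hab hst hνa hνb e he m p _ (fun q hq => (Finset.mem_filter.mp hq).2) M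
        (fun q hq => ?_))
    have hq1 := Finset.mem_filter.mp hq
    have hq2 := Finset.mem_filter.mp hq1.1
    have hqp : q.1.1 = p := hq1.2
    rcases Nat.eq_zero_or_pos M with hM0 | hM1
    · exact Or.inl (by rw [hM0]; simp)
    have hkl : q.1.1.1 < q.1.1.2 := lt_of_lt_of_le q.1.2.1 q.1.2.2
    have hfq := hfar q hq2.1
    have hsmall : 2 * h_hi * ((q.1.1.2 - q.1.1.1 : ℤ) : ℝ) ≤ R := not_lt.mp hq2.2
    have hHt := (heights_of_le hH hkl.le).2
    have hn : |⟪e 0, w q.1.1.1 - layerPoint a b w (q.1.1.2, q.2)⟫| ≤ R / 2 := by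
      rw [he, inner_sub_right, inner_layerPoint hνa hνb]
      have hpos : 0 ≤ ⟪ν, w q.1.1.2⟫ - ⟪ν, w q.1.1.1⟫ := by
        have := (heights_of_le hH hkl.le).1
        have : (0 : ℝ) ≤ h_lo * ((q.1.1.2 - q.1.1.1 : ℤ) : ℝ) :=
          mul_nonneg hlo.le (by exact_mod_cast (show (0 : ℤ) ≤ q.1.1.2 - q.1.1.1 by omega))
        linarith
      rw [abs_sub_comm, abs_of_nonneg hpos]
      linarith
    rw [← hqp]
    exact exists_planar_coord_far hδ e hM1 hMR hfq.le hn
  have hβ' : Kc δ * γ * (32 / ((M : ℝ) + 1)) * (2 / ((1 : ℕ) : ℝ)) ≤ 64 * Kc δ * γ * δ / R := by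
    have h1 : R / δ < (M : ℝ) + 1 := Nat.lt_floor_add_one _
    have h2 : (1 : ℝ) / ((M : ℝ) + 1) ≤ δ / R := by
      rw [div_le_div_iff₀ (by positivity) hR]
      rw [div_lt_iff₀ hδ] at h1
      linarith
    have h4 : 0 ≤ Kc δ * γ * 64 := by positivity
    calc Kc δ * γ * (32 / ((M : ℝ) + 1)) * (2 / ((1 : ℕ) : ℝ)) = Kc δ * γ * 64 * (1 / ((M : ℝ) + 1)) := by norm_num; ring
      _ ≤ Kc δ * γ * 64 * (δ / R) := mul_le_mul_of_nonneg_left h2 h4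
      _ = 64 * Kc δ * γ * δ / R := by ring
  calc ∑ q ∈ T.filter A, ‖gapFam a b w m q‖ + ∑ q ∈ T.filter (fun q => ¬A q), ‖gapFam a b w m q‖
        ≤ 128 * Kc δ * γ * h_hi / R + 64 * Kc δ * γ * δ / R := add_le_add (hα.trans hα') (hβ.trans hβ')
    _ = 64 * Kc δ * (δ / (2 * h_lo)) ^ 3 * (2 * h_hi + δ) / R := by rw [hγ]; ring

end Master

end Summit.AtomisticToContinuum.Crystallization.Theorems.ChartedPlanarOrderPlanesPairs
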